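import Mathlib.RingTheory.LocalProperties.Basic
import Mathlib.RingTheory.Localization.AtPrime.Basic
import Literature.AlgebraicGeometry.Resolution.WeightedMonomialQuasiRegular
import Literature.AlgebraicGeometry.Resolution.CobordantBlowupRegular
import Literature.AlgebraicGeometry.Resolution.RegularQuotientIdeal
import Literature.AlgebraicGeometry.Resolution.CobordantBlowupAffineSpace
import HarnessLib

/-!
# Cobordant blow-ups (Włodarczyk 2022), VII: regularity of `B` at a regular weighted centre

Topic: `Literature/AlgebraicGeometry/Resolution`. Conclusion of `WeightedMonomialIdeals.lean`,
`WeightedMonomialQuasiRegular.lean` and `CobordantBlowupRegular.lean`: J. Włodarczyk, *Functorial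
resolution by torus actions*, arXiv:2203.03090, §2.3.9 — **the full cobordant blow-up
`B = Spec A[t⁻¹, u₁ t^{w₁}, …, u_k t^{w_k}]` of a regular affine scheme `Spec A` at a regular weighted
centre is regular** — with the hypotheses in the form of a *regular weighted chart* (Def. 2.1.10: the
`uᵢ` are part of a regular system of parameters at every point of `V(u)`; in the tree:
`ReesAlgebraData.IsWeightedChart.linearIndependent` of `WeightedResolutionDatum.lean`): at every prime
`P ⊇ (u)` some localisation of `A` at `P` — e.g. the stalk `𝒪_{Spec A, P}` — is a regular local ring
in whose cotangent space the `uᵢ` are linearly independent. PROVED: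

* `map_weightedFiltration_ideal` — `𝒥ₙ(u) A' = 𝒥ₙ(g ∘ u)` along `g : A → A'`;
* `weightedQuasiRegular_of_localization` — weighted quasi-regularity is local on the maximal ideals
  containing `(u)` (`Ideal.mem_of_localization_maximal`);
* `weightedQuasiRegular_of_linearIndependent_toCotangent` — in a regular local ring, elements with
  independent differentials are weighted quasi-regular for all positive weights (they form a
  permutable regular family, `RegularQuotientIdeal.lean`, so `coeff_mem_span_of_isWeightedHomogeneous`
  applies);
* `isRegularRing_quotient_of_localization`, `isRegularLocalRing_quotient_span_range` — `A/(u)` is a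
  regular ring (Matsumura Thm. 14.2 at each prime);
* `cobordantAlgebra.isRegularRing_of_linearIndependent_toCotangent` — **§2.3.9**: `𝒪_B` is a regular
  ring (`cobordantAlgebra.isRegularRing`).

Consequences for the route `ResolutionOfSingularities/WeightedInvariant` (items stmt-0572/8974): the
cobordant blow-up `B₊ ⊆ B` of the datum's regular weighted centre on a smooth `Y` is regular, hence
smooth over the perfect ground field (`smooth_of_isRegular_of_perfectField`), so the datum's axioms
apply to `(B₊, strict transform)` again.

## Sources

* J. Włodarczyk, arXiv:2203.03090 (July 2025 version), Def. 2.1.10, §2.3.9. [Wlodarczyk2022]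
* H. Matsumura, *Commutative Ring Theory*, CUP 1986, Thm. 14.2, Thm. 16.2. [Matsumura1987]
-/

noncomputable section

namespace Literature.AlgebraicGeometry.Resolution

open MvPolynomial IsLocalRing

universe u v

section LocalToGlobal

variable {A : Type u} [CommRing A] {ι : Type v} (u : ι → A) (w : ι → ℕ)

/-- The weighted monomials transform along a ring map: `g(u^α) = (g ∘ u)^α`, so
`g(𝒥ₙ(u)) A' = 𝒥ₙ(g ∘ u)`. [folklore] -/
theorem map_weightedFiltration_ideal {A' : Type*} [CommRing A'] (g : A →+* A') (n : ℕ) :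
    ((weightedFiltration u w).ideal n).map g = (weightedFiltration (g ∘ u) w).ideal n := by
  rw [weightedFiltration_ideal, weightedFiltration_ideal, Ideal.map_span]
  congr 1
  ext x
  constructor
  · rintro ⟨_, ⟨α, hα, rfl⟩, rfl⟩
    refine ⟨α, hα, ?_⟩
    rw [map_finsuppProd]
    simp only [map_pow, Function.comp]
  · rintro ⟨α, hα, rfl⟩
    refine ⟨_, ⟨α, hα, rfl⟩, ?_⟩
    rw [map_finsuppProd]
    simp only [map_pow, Function.comp]

/-- **Weighted quasi-regularity is local**: if for every maximal ideal `𝔪 ⊇ (u)` there is a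
localisation `R` of `A` at `𝔪` in which the images of the `uᵢ` are weighted quasi-regular, then `u`
is weighted quasi-regular in `A` (at maximal ideals not containing `(u)` there is nothing to check:
`(u)` localises to the unit ideal). [folklore] -/
theorem weightedQuasiRegular_of_localization
    (hloc : ∀ (𝔪 : Ideal A) [𝔪.IsMaximal], Ideal.span (Set.range u) ≤ 𝔪 →
      ∃ (R : Type u) (_ : CommRing R) (_ : Algebra A R) (_ : IsLocalization.AtPrime R 𝔪),
        ∀ (n : ℕ) (P : MvPolynomial ι R), P.IsWeightedHomogeneous w n →
          MvPolynomial.eval (algebraMap A R ∘ u) P ∈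
            (weightedFiltration (algebraMap A R ∘ u) w).ideal (n + 1) →
          ∀ β, P.coeff β ∈ Ideal.span (Set.range (algebraMap A R ∘ u)))
    (n : ℕ) (P : MvPolynomial ι A) (hP : P.IsWeightedHomogeneous w n)
    (heval : MvPolynomial.eval u P ∈ (weightedFiltration u w).ideal (n + 1)) (β : ι →₀ ℕ) :
    P.coeff β ∈ Ideal.span (Set.range u) := by
  set I := Ideal.span (Set.range u) with hI
  refine Ideal.mem_of_localization_maximal fun 𝔪 h𝔪 => ?_
  by_cases hI𝔪 : I ≤ 𝔪
  · obtain ⟨R, _, _, _, hR⟩ := hloc 𝔪 hI𝔪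
    -- the image polynomial is homogeneous of the same weight and evaluates into `𝒥ₙ₊₁ R`
    set P' := MvPolynomial.map (algebraMap A R) P with hP'
    have hP'h : P'.IsWeightedHomogeneous w n := by
      intro d hd
      rw [hP', MvPolynomial.coeff_map] at hd
      exact hP (fun h => hd (by rw [h, map_zero]))
    have hev' : MvPolynomial.eval (algebraMap A R ∘ u) P' ∈
        (weightedFiltration (algebraMap A R ∘ u) w).ideal (n + 1) := by
      rw [hP', MvPolynomial.eval_map, ← MvPolynomial.eval₂_comp, ← map_weightedFiltration_ideal]
      exact Ideal.mem_map_of_mem _ heval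
    have hmem := hR n P' hP'h hev' β
    rw [hP', MvPolynomial.coeff_map, Set.range_comp, ← Ideal.map_span] at hmem
    -- transport along the `A`-isomorphism `R ≅ A_𝔪`
    let φ : R ≃ₐ[A] Localization.AtPrime 𝔪 := IsLocalization.algEquiv 𝔪.primeCompl R _
    have h2 := Ideal.mem_map_of_mem (φ : R →+* Localization.AtPrime 𝔪) hmem
    rw [Ideal.map_map] at h2
    have hφ : (φ : R →+* Localization.AtPrime 𝔪).comp (algebraMap A R) =
        algebraMap A (Localization.AtPrime 𝔪) := φ.toAlgHom.comp_algebraMap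
    rwa [hφ, RingHom.coe_coe, AlgEquiv.commutes] at h2
  · -- some `uᵢ ∉ 𝔪` becomes a unit
    have : I.map (algebraMap A (Localization.AtPrime 𝔪)) = ⊤ := by
      rw [Ideal.eq_top_iff_one]
      have h1 : ¬ (Set.range u ⊆ 𝔪) := fun h => hI𝔪 (Ideal.span_le.mpr h)
      obtain ⟨_, ⟨i, rfl⟩, hi⟩ := Set.not_subset.mp h1
      have hu : IsUnit (algebraMap A (Localization.AtPrime 𝔪) (u i)) :=
        IsLocalization.map_units _ (⟨u i, hi⟩ : 𝔪.primeCompl)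
      have hmem : algebraMap A (Localization.AtPrime 𝔪) (u i) ∈ I.map (algebraMap A _) :=
        Ideal.mem_map_of_mem _ (Ideal.subset_span ⟨i, rfl⟩)
      exact (Ideal.eq_top_of_isUnit_mem _ hmem hu) ▸ Submodule.mem_top
    rw [this]; exact Submodule.mem_top

/-- **Weighted quasi-regularity in a regular local ring**: if `(R, 𝔪)` is a regular local ring and
`u₁, …, u_k ∈ 𝔪` have linearly independent images in `𝔪/𝔪²` (part of a regular system of
parameters), then for positive weights `u` is weighted quasi-regular: a `w`-form `P` of weight `n`
with `P(u) ∈ 𝒥ₙ₊₁` has all its coefficients in `(u)`. (`u` is a permutable regular family,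
`RegularQuotientIdeal.lean`, and `coeff_mem_span_of_isWeightedHomogeneous` applies.) [folklore] -/
theorem weightedQuasiRegular_of_linearIndependent_toCotangent {R : Type u} [CommRing R]
    [IsRegularLocalRing R] {k : ℕ} (f : Fin k → R) (w : Fin k → ℕ) (hw : ∀ i, 0 < w i)
    (hf : ∀ i, f i ∈ maximalIdeal R)
    (hli : LinearIndependent (ResidueField R) fun i => (maximalIdeal R).toCotangent ⟨f i, hf i⟩)
    (n : ℕ) (P : MvPolynomial (Fin k) R) (hP : P.IsWeightedHomogeneous w n)
    (heval : MvPolynomial.eval f P ∈ (weightedFiltration f w).ideal (n + 1)) (β : Fin k →₀ ℕ) :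
    P.coeff β ∈ Ideal.span (Set.range f) := by
  classical
  have hperm : ∀ i ∈ (Finset.univ : Finset (Fin k)), ∀ T : Set (Fin k), T ⊆ ↑(Finset.univ : Finset (Fin k)) →
      i ∉ T → ∀ y : R, f i * y ∈ Ideal.span (f '' T) → y ∈ Ideal.span (f '' T) :=
    fun i _ T _ hiT y hy => mem_span_image_of_mul_mem_of_linearIndependent_toCotangent f hf hli i T hiT y hy
  have key := coeff_mem_span_of_isWeightedHomogeneous f w Finset.univ (fun i _ => hw i) hperm hP
    (fun β _ => by simp) ?_ β
  · simpa [Set.image_univ] using key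
  · rw [weightedFiltration_ideal] at heval
    refine (show Ideal.span (weightedMonomials f w (n + 1)) ≤ _ from Ideal.span_mono ?_) heval
    rintro x ⟨α, hα, rfl⟩
    exact ⟨α, by simp, hα, rfl⟩

/-- **Regularity of a quotient is local**: if `A` is Noetherian and for every prime `P ⊇ I` some
localisation `R` of `A` at `P` has `R / I R` a regular local ring, then `A / I` is a regular ring.
[folklore] -/
theorem isRegularRing_quotient_of_localization [IsNoetherianRing A] (I : Ideal A)
    (hloc : ∀ (P : Ideal A) [P.IsPrime], I ≤ P →
      ∃ (R : Type u) (_ : CommRing R) (_ : Algebra A R) (_ : IsLocalization.AtPrime R P),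
        IsRegularLocalRing (R ⧸ I.map (algebraMap A R))) :
    IsRegularRing (A ⧸ I) := by
  refine isRegularRing_iff.mpr fun Qbar hQbar => ?_
  set Q : Ideal A := Qbar.comap (Ideal.Quotient.mk I) with hQ
  haveI hQp : Q.IsPrime := Ideal.comap_isPrime _ _
  have hIQ : I ≤ Q := fun a ha => by
    rw [hQ, Ideal.mem_comap, Ideal.Quotient.eq_zero_iff_mem.mpr ha]; exact Ideal.zero_mem _
  obtain ⟨R, _, _, _, hR⟩ := hloc Q hIQ
  -- `(A/I)_{Q̄}` is the quotient of the localisation `A_Q ≅ R` by `I`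
  have hmemQ : ∀ c : A, Ideal.Quotient.mk I c ∈ Qbar ↔ c ∈ Q := fun c => by rw [hQ, Ideal.mem_comap]
  have hM : Algebra.algebraMapSubmonoid (A ⧸ I) Q.primeCompl = Qbar.primeCompl := by
    ext b
    constructor
    · rintro ⟨c, hc, rfl⟩
      exact fun h => hc ((hmemQ c).mp h)
    · intro hb
      obtain ⟨c, rfl⟩ := Ideal.Quotient.mk_surjective b
      exact ⟨c, fun h => hb ((hmemQ c).mpr h), rfl⟩
  haveI : IsLocalization.AtPrime (R ⧸ I.map (algebraMap A R)) Qbar := by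
    have := (inferInstance : IsLocalization (Algebra.algebraMapSubmonoid (A ⧸ I) Q.primeCompl)
      (R ⧸ I.map (algebraMap A R)))
    rwa [hM] at this
  exact IsRegularLocalRing.of_ringEquiv (IsLocalization.algEquiv Qbar.primeCompl
    (R ⧸ I.map (algebraMap A R)) (Localization.AtPrime Qbar)).toRingEquiv

/-- In a regular local ring, the quotient by elements with linearly independent differentials is a
regular local ring — `isRegularLocalRing_quotient_span` for a family. [cite: Matsumura1987, Thm. 14.2] -/
theorem isRegularLocalRing_quotient_span_range {R : Type u} [CommRing R] [IsRegularLocalRing R]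
    {k : ℕ} (f : Fin k → R) (hf : ∀ i, f i ∈ maximalIdeal R)
    (hli : LinearIndependent (ResidueField R) fun i => (maximalIdeal R).toCotangent ⟨f i, hf i⟩) :
    IsRegularLocalRing (R ⧸ Ideal.span (Set.range f)) := by
  classical
  have hinj : Function.Injective f := injective_of_linearIndependent_toCotangent f hf hli
  set s : Finset R := Finset.univ.image f with hs
  have hsr : (s : Set R) = Set.range f := by simp [hs]
  have hsm : (s : Set R) ⊆ maximalIdeal R := by rw [hsr]; rintro _ ⟨i, rfl⟩; exact hf i
  -- reindex the family by `s`
  have hli' : LinearIndependent (ResidueField R) (fun x : s => (maximalIdeal R).toCotangent ⟨x, hsm x.2⟩) := by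
    have hex : ∀ x : s, ∃ i : Fin k, f i = x := fun x => by
      have hx := x.2
      rw [← Finset.mem_coe, hsr] at hx
      exact hx
    choose e he using hex
    have heinj : Function.Injective e := fun x y hxy => Subtype.ext (by rw [← he x, ← he y, hxy])
    convert hli.comp e heinj using 1
    funext x
    simp only [Function.comp, he x]
  have h := isRegularLocalRing_quotient_span s hsm hli'
  rwa [hsr] at h

end LocalToGlobal

/-! ## Regularity of the cobordant algebra at a regular weighted centre -/

section Centre

variable {A : Type u} [CommRing A] {k : ℕ} (u : Fin k → A) (w : Fin k → ℕ)

/-- **Włodarczyk 2.3.9, affine form with the hypotheses of a regular weighted chart**: let `A` be a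
regular ring, `w` positive weights, and suppose that at every prime `P ⊇ (u)` some localisation
`(R, 𝔪)` of `A` at `P` (e.g. the stalk of `Spec A`) is a regular local ring in which the `uᵢ` have
linearly independent images in `𝔪/𝔪²` ("the `uᵢ` are part of a regular system of parameters at the
points of `V(u)`", Def. 2.1.10). Then the algebra `A[t⁻¹, u₁ t^{w₁}, …, u_k t^{w_k}]` of the full
cobordant blow-up is a regular ring. [cite: Wlodarczyk2022, §2.3.9] -/
theorem cobordantAlgebra.isRegularRing_of_linearIndependent_toCotangent [IsRegularRing A]
    (hw : ∀ i, 0 < w i)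
    (hloc : ∀ (P : Ideal A) [P.IsPrime], Ideal.span (Set.range u) ≤ P →
      ∃ (R : Type u) (_ : CommRing R) (_ : Algebra A R) (_ : IsLocalization.AtPrime R P)
        (_ : IsRegularLocalRing R) (hmem : ∀ i, algebraMap A R (u i) ∈ maximalIdeal R),
        LinearIndependent (ResidueField R)
          fun i => (maximalIdeal R).toCotangent ⟨algebraMap A R (u i), hmem i⟩) :
    IsRegularRing (cobordantAlgebra u w) := by
  -- `A/(u)` is a regular ring
  haveI : IsRegularRing (A ⧸ Ideal.span (Set.range u)) := by
    refine isRegularRing_quotient_of_localization (Ideal.span (Set.range u)) fun P _ hP => ?_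
    obtain ⟨R, _, _, _, _, hmem, hli⟩ := hloc P hP
    refine ⟨R, inferInstance, inferInstance, inferInstance, ?_⟩
    rw [Ideal.map_span, ← Set.range_comp]
    exact isRegularLocalRing_quotient_span_range _ hmem hli
  -- `u` is weighted quasi-regular
  refine cobordantAlgebra.isRegularRing u w hw ?_
  refine weightedQuasiRegular_of_localization u w fun 𝔪 _ h𝔪 => ?_
  obtain ⟨R, _, _, _, _, hmem, hli⟩ := hloc 𝔪 h𝔪
  exact ⟨R, inferInstance, inferInstance, inferInstance,
    weightedQuasiRegular_of_linearIndependent_toCotangent _ w hw hmem hli⟩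

end Centre


/-! ## The schemes `B` and `B₊` -/

section Schemes

open _root_.AlgebraicGeometry

variable {A : Type u} [CommRing A] {k : ℕ} (u : Fin k → A) (w : Fin k → ℕ)

/-- **The full cobordant blow-up `B = Spec A[t⁻¹, uᵢ t^{wᵢ}]` at a regular weighted centre of a
regular affine scheme is a regular scheme** (Włodarczyk, §2.3.9). [cite: Wlodarczyk2022, §2.3.9] -/
theorem cobordantBlowup.isRegular_of_linearIndependent_toCotangent [IsRegularRing A]
    (hw : ∀ i, 0 < w i)
    (hloc : ∀ (P : Ideal A) [P.IsPrime], Ideal.span (Set.range u) ≤ P →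
      ∃ (R : Type u) (_ : CommRing R) (_ : Algebra A R) (_ : IsLocalization.AtPrime R P)
        (_ : IsRegularLocalRing R) (hmem : ∀ i, algebraMap A R (u i) ∈ maximalIdeal R),
        LinearIndependent (ResidueField R)
          fun i => (maximalIdeal R).toCotangent ⟨algebraMap A R (u i), hmem i⟩) :
    Scheme.IsRegular (cobordantBlowup u w) := by
  haveI := cobordantAlgebra.isRegularRing_of_linearIndependent_toCotangent u w hw hloc
  exact Scheme.isRegular_Spec (.of _)

/-- **The cobordant blow-up `B₊ = B ∖ Vert(B)` at a regular weighted centre of a regular affine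
scheme is a regular scheme** (an open subscheme of the regular `B`; Włodarczyk, §2.3.9).
[cite: Wlodarczyk2022, §2.3.9] -/
theorem cobordantBlowup.isRegular_plus_of_linearIndependent_toCotangent [IsRegularRing A]
    (hw : ∀ i, 0 < w i)
    (hloc : ∀ (P : Ideal A) [P.IsPrime], Ideal.span (Set.range u) ≤ P →
      ∃ (R : Type u) (_ : CommRing R) (_ : Algebra A R) (_ : IsLocalization.AtPrime R P)
        (_ : IsRegularLocalRing R) (hmem : ∀ i, algebraMap A R (u i) ∈ maximalIdeal R),
        LinearIndependent (ResidueField R)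
          fun i => (maximalIdeal R).toCotangent ⟨algebraMap A R (u i), hmem i⟩) :
    Scheme.IsRegular (cobordantBlowup.plus u w : Scheme.{u}) :=
  Scheme.IsRegular.of_isOpenImmersion (cobordantBlowup.plus u w).ι
    (cobordantBlowup.isRegular_of_linearIndependent_toCotangent u w hw hloc)

end Schemes

end Literature.AlgebraicGeometry.Resolution

end
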